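import Summits.HodgeConjecture.HodgeConjecture.Theorems.F0P2aCmFrameFactorisation
import Summits.HodgeConjecture.HodgeConjecture.Theorems.F0P2aL2bMatrixChartSmooth
import Literature.NumberTheory.Automorphic.ArchimedeanCalculusProofs
import Literature.NumberTheory.Automorphic.ArchimedeanLieDerivSpans
import HarnessLib

/-!
# FLOOR-0 P2a · B4-ARCHIMEDEAN DESK, line 2 `F0_P2aCohIsotypicLine` — support L2B-i (`sig_L2Bi`): the coordinates of a HOLOMORPHIC cotangent
# form are SMOOTH IN THE ARCHIMEDEAN VARIABLE along `ι_∞ = cmArchSection`, and so are all their iterated Lie derivatives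

Cell hodgecm-mathlib (D-0151), FLOOR 0; crux item H413 = stmt-HodgeConjecture-24833 (route `HCCMUnconditional`); line
`Cruxes/H413/Lines/F0_P2aCohIsotypicLine.lean` (F0P2a-plan (g2), sha16 fe64be0a9875628f), S2⁺ `stub_archOrth_hol` CUT of F0P2a-p01 (LEAD)
`F0/P2a/F0P2a-p01/CUT-S2plus.v1.md`, sub-lemma **L2B-i** (owner F0P2a-p03): hypothesis (W1) «arch-smooth» of the `W`-package / of ★
`closure_l2OfForms_exp_invariant_of_analytic` for the `U(𝔤)`-span of the coordinates of a holomorphic cotangent form.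
THEOREMS ONLY (no `def`, no instance, no notation, no named fact, no `sorry`); `--supports stmt-HodgeConjecture-24833`.
HC_CM is proved only modulo the 7 printed citations until rung 0 closes; this file discharges none of them.

## What is proved (`H := BallForms.u21Group`, Lie calculus of ★ `ArchimedeanCalculus`)
* §1 generic glue for a section `ι : U(2,1) →* G` into ANY group: `isArchSmooth_of_isArchSmooth_slices` (all slices `u ↦ φ (x · ι u)` arch-smooth
  for `id` ⇒ `φ` arch-smooth for `ι`; converse of ★ `BallForms.isArchSmooth_comp`), `lieDeriv_slice_apply` / `iterLieDeriv_slice`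
  (Lie derivatives along `ι` commute with taking slices), and invariance bookkeeping for the `W`-package: `lieDeriv_apply_mul_left`,
  `iterLieDeriv_apply_mul_left` (LEFT-invariance is inherited by Lie derivatives), `lieDeriv_apply_mul_right_of_forall_commute`,
  `iterLieDeriv_apply_mul_right_of_forall_commute` (RIGHT-invariance under an element commuting with `ι(U(2,1))` is inherited) [BorelJacquet1979, §1.5].
* §2 `isArchSmooth_apply_of_weight_isHolGerm` — ANY group `G`, any `ι`: a weight form of cotangent `K_∞`-type along `ι` with holomorphic germs along
  `ι` (`CotangentForms.IsHolGerm`) has arch-smooth coordinates (slices = cotangent group functions of HOLOMORPHIC ball functions, ★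
  `F0P2aCmFrameFactorisation.exists_mem_holomorphic_slice_eq`; those are arch-smooth, ★ `F0P2aL2bMatrixChartSmooth.isArchSmooth_toGroupFun_of_mem_holomorphic`);
  `isArchSmooth_iterLieDeriv_apply_of_weight_isHolGerm` (★ `isArchSmooth_lieDeriv_holds`); the CM-frame instances `isArchSmooth_apply_of_mem_holCotForms_cm`,
  `isArchSmooth_iterLieDeriv_apply_of_mem_holCotForms_cm`, and **`sig_L2Bi_holds`** = p01's `sig_L2Bi` TOKEN FOR TOKEN [Borel1997, §5.14].

## References
* [BorelJacquet1979] A. Borel, H. Jacquet, Corvallis PSPM 33.1, §1.1, §1.5, §4.1.  [Borel1997] A. Borel, *Automorphic forms on SL₂(ℝ)*, §5.14.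
* [Chirka1989] E. M. Chirka, *Complex Analytic Sets*, A1.1 (holomorphic ⇒ `C^∞`).
* Tree: ★ `Theorems/F0P2aCmFrameFactorisation` §1, ★ `Theorems/F0P2aL2bMatrixChartSmooth`, ★ `Automorphic/ArchimedeanCalculus(Proofs)`,
  `ArchimedeanLieDerivSpans` (`IsArchSmooth.iterLieDeriv_of`), ★ `ShimuraVarieties/UnitaryBallLieDerivative` (`u21Group`, `isArchSmooth_comp`).
-/

set_option autoImplicit false

-- the mandated namespace has the single-problem summit's repeated segment (`HodgeConjecture.HodgeConjecture`)
set_option linter.dupNamespace false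

noncomputable section

open scoped Matrix MatrixGroups Matrix.Norms.Operator Topology ContDiff ComplexOrder
open NumberField NumberField.InfinitePlace MulAction
open Literature.Geometry.ComplexHyperbolic Literature.Geometry.ComplexHyperbolic.BallModel
open Literature.NumberTheory.Automorphic Literature.NumberTheory.Automorphic.AutomorphyFactor Literature.NumberTheory.Automorphic.UnitaryGroup
open Literature.NumberTheory.Automorphic.UnitaryGroup.CotangentForms (cmArchSection cmCompactFactor)
open Literature.AlgebraicGeometry.ShimuraVarieties Literature.AlgebraicGeometry.ShimuraVarieties.BallForms
open Summit.HodgeConjecture.HodgeConjecture.Cruxes.H413.F0P2aCmFrameFactorisation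
open Summit.HodgeConjecture.HodgeConjecture.Cruxes.H413.F0P2aL2bMatrixChartSmooth

namespace Summit.HodgeConjecture.HodgeConjecture.Cruxes.H413.F0P2aL2bHolArchSmooth

/-! ## §1 Sections `ι : U(2,1) →* G`: slices, Lie derivatives, invariances -/

section Glue

variable {G : Type*} [Group G] (ι : ↥U21 →* G)

/-- **Arch-smoothness from arch-smoothness of all slices**: if every slice `u ↦ φ (x · ι u)` is `IsArchSmooth` on `U(2,1)` (section `id`),
then `φ` is `IsArchSmooth` along `ι` (the slice at `x` through `u = 1` is the exponential slice of `φ` at `x`). Converse of ★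
`BallForms.isArchSmooth_comp`. [cite: BorelJacquet1979, §1.1] -/
theorem isArchSmooth_of_isArchSmooth_slices {φ : G → ℂ}
    (h : ∀ x : G, IsArchSmooth (H := u21Group) (MonoidHom.id U21) fun u => φ (x * ι u)) :
    IsArchSmooth (H := u21Group) ι φ := by
  intro x
  have h1 := h x 1
  simp only [one_mul] at h1
  exact h1

/-- Lie derivatives along `ι` commute with taking slices: `X (u ↦ φ (x · ι u)) (u) = (X φ)(x · ι u)`. [cite: BorelJacquet1979, §1.5] -/
theorem lieDeriv_slice_apply (X : u21Group.lie) (φ : G → ℂ) (x : G) (u : ↥U21) :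
    lieDeriv (MonoidHom.id U21) X (fun v => φ (x * ι v)) u = lieDeriv ι X φ (x * ι u) := by
  simp only [lieDeriv]
  congr 1
  funext t
  show φ (x * ι (u * (MonoidHom.id U21) (u21Group.expMem (t • X)))) = φ (x * ι u * ι (u21Group.expMem (t • X)))
  rw [map_mul, mul_assoc]
  rfl

/-- Iterated Lie derivatives along `ι` commute with taking slices. [cite: BorelJacquet1979, §1.5] -/
theorem iterLieDeriv_slice (w : List u21Group.lie) (φ : G → ℂ) (x : G) :
    iterLieDeriv (MonoidHom.id U21) w (fun v => φ (x * ι v)) = fun u => iterLieDeriv ι w φ (x * ι u) := by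
  induction w with
  | nil => rfl
  | cons X w ih =>
    rw [iterLieDeriv_cons, iterLieDeriv_cons, ih]
    funext u
    exact lieDeriv_slice_apply ι X (iterLieDeriv ι w φ) x u

/-- LEFT-invariance is inherited by Lie derivatives (they act on the right). [cite: BorelJacquet1979, §1.5] -/
theorem lieDeriv_apply_mul_left (X : u21Group.lie) {φ : G → ℂ} {γ : G} (hφ : ∀ y, φ (γ * y) = φ y) (y : G) :
    lieDeriv ι X φ (γ * y) = lieDeriv ι X φ y := by
  simp only [lieDeriv, mul_assoc, hφ]

/-- LEFT-invariance is inherited by iterated Lie derivatives. [cite: BorelJacquet1979, §1.5] -/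
theorem iterLieDeriv_apply_mul_left (w : List u21Group.lie) {φ : G → ℂ} {γ : G} (hφ : ∀ y, φ (γ * y) = φ y) :
    ∀ y, iterLieDeriv ι w φ (γ * y) = iterLieDeriv ι w φ y := by
  induction w with
  | nil => exact hφ
  | cons X w ih => intro y; rw [iterLieDeriv_cons]; exact lieDeriv_apply_mul_left ι X ih y

/-- RIGHT-invariance under an element `k` commuting with `ι(U(2,1))` is inherited by Lie derivatives
(`φ (y k ι(e^{tX})) = φ (y ι(e^{tX}) k) = φ (y ι(e^{tX}))`). [cite: BorelJacquet1979, §1.5] -/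
theorem lieDeriv_apply_mul_right_of_forall_commute (X : u21Group.lie) {φ : G → ℂ} {k : G} (hk : ∀ u : ↥U21, ι u * k = k * ι u)
    (hφ : ∀ y, φ (y * k) = φ y) (y : G) :
    lieDeriv ι X φ (y * k) = lieDeriv ι X φ y := by
  simp only [lieDeriv]
  congr 1
  funext t
  show φ (y * k * ι (u21Group.expMem (t • X))) = φ (y * ι (u21Group.expMem (t • X)))
  rw [mul_assoc, ← hk, ← mul_assoc, hφ]

/-- RIGHT-invariance under an element commuting with `ι(U(2,1))` is inherited by iterated Lie derivatives. [cite: BorelJacquet1979, §1.5] -/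
theorem iterLieDeriv_apply_mul_right_of_forall_commute (w : List u21Group.lie) {φ : G → ℂ} {k : G} (hk : ∀ u : ↥U21, ι u * k = k * ι u)
    (hφ : ∀ y, φ (y * k) = φ y) :
    ∀ y, iterLieDeriv ι w φ (y * k) = iterLieDeriv ι w φ y := by
  induction w with
  | nil => exact hφ
  | cons X w ih => intro y; rw [iterLieDeriv_cons]; exact lieDeriv_apply_mul_right_of_forall_commute ι X hk ih y

end Glue

/-! ## §2 Holomorphic cotangent weight forms are arch-smooth along the section (any group), and the CM frame -/

section Hol

variable {G : Type*} [Group G] (ι : ↥U21 →* G) {Γ : Subgroup G}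

/-- **Coordinates of a cotangent weight form with holomorphic germs are smooth in the archimedean variable** (ANY group `G`, any section
`ι : U(2,1) →* G`): every slice is the cotangent group function of a HOLOMORPHIC ball function (★ `exists_mem_holomorphic_slice_eq`), which is
arch-smooth (★ `isArchSmooth_toGroupFun_of_mem_holomorphic`). [cite: Borel1997, §5.14] [cite: BorelJacquet1979, §1.1] -/
theorem isArchSmooth_apply_of_weight_isHolGerm {f : G → (Fin 2 → ℂ)}
    (hW : f ∈ weightForms Γ (ι.comp (stabilizer (↥U21) x₀).subtype) (BallForms.isPullbackCocycle_cotangentCocycle.weightOf x₀))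
    (hH : CotangentForms.IsHolGerm ι f) (j : Fin 2) :
    IsArchSmooth (H := u21Group) ι fun x => f x j := by
  refine isArchSmooth_of_isArchSmooth_slices ι fun x => ?_
  obtain ⟨Fb, hFb, heq⟩ := exists_mem_holomorphic_slice_eq ι hW hH x
  have e : (fun u : ↥U21 => f (x * ι u) j) = fun u => toGroupFun BallForms.cotangentCocycle x₀ Fb u j := by
    funext u
    exact congrFun (congrFun heq u) j
  rw [e]
  exact isArchSmooth_toGroupFun_of_mem_holomorphic hFb j

/-- All iterated Lie derivatives (along `ι`, `Xᵢ ∈ 𝔲(2,1)`) of the coordinates of a cotangent weight form with holomorphic germs are smooth in the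
archimedean variable (★ `isArchSmooth_lieDeriv_holds`). [cite: BorelJacquet1979, §1.5] -/
theorem isArchSmooth_iterLieDeriv_apply_of_weight_isHolGerm {f : G → (Fin 2 → ℂ)}
    (hW : f ∈ weightForms Γ (ι.comp (stabilizer (↥U21) x₀).subtype) (BallForms.isPullbackCocycle_cotangentCocycle.weightOf x₀))
    (hH : CotangentForms.IsHolGerm ι f) (j : Fin 2) (w : List u21Group.lie) :
    IsArchSmooth (H := u21Group) ι (iterLieDeriv ι w fun x => f x j) :=
  (isArchSmooth_apply_of_weight_isHolGerm ι hW hH j).iterLieDeriv_of isArchSmooth_lieDeriv_holds w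

end Hol

section CM

variable (L : Type) [Field L] [NumberField L] [IsCMField L] (ι : L →+* ℂ) (H : Matrix (Fin 3) (Fin 3) L) (T : GL (Fin 3) ℂ)
  (hT : (T : Matrix (Fin 3) (Fin 3) ℂ)ᴴ * H.map ι * (T : Matrix (Fin 3) (Fin 3) ℂ) = Literature.Geometry.ComplexHyperbolic.BallModel.J)

/-- **Coordinates of holomorphic cotangent forms of the CM frame are smooth in the archimedean variable** along `ι_∞ = cmArchSection`.
[cite: Borel1997, §5.14] [cite: BorelJacquet1979, §1.1 and §4.1] -/
theorem isArchSmooth_apply_of_mem_holCotForms_cm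
    {Φ : (adelicGroupData (↥(maximalRealSubfield L)) L (IsCMField.complexConj L) 3 H).Adelic → (Fin 2 → ℂ)}
    (hΦ : Φ ∈ CotangentForms.holCotForms (↥(maximalRealSubfield L)) L (IsCMField.complexConj L) 3 H (cmArchSection L ι H T hT)
      (cmCompactFactor L ι H T hT)) (j : Fin 2) :
    IsArchSmooth (H := u21Group) (cmArchSection L ι H T hT) fun x => Φ x j := by
  obtain ⟨hW, -, -, hH⟩ := CotangentForms.mem_holCotForms_iff.1 hΦ
  exact isArchSmooth_apply_of_weight_isHolGerm (cmArchSection L ι H T hT) hW hH j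

/-- All iterated Lie derivatives along `cmArchSection` of the coordinates of a holomorphic cotangent form of the CM frame are smooth in the
archimedean variable. [cite: BorelJacquet1979, §1.5] -/
theorem isArchSmooth_iterLieDeriv_apply_of_mem_holCotForms_cm
    {Φ : (adelicGroupData (↥(maximalRealSubfield L)) L (IsCMField.complexConj L) 3 H).Adelic → (Fin 2 → ℂ)}
    (hΦ : Φ ∈ CotangentForms.holCotForms (↥(maximalRealSubfield L)) L (IsCMField.complexConj L) 3 H (cmArchSection L ι H T hT)
      (cmCompactFactor L ι H T hT)) (j : Fin 2) (w : List u21Group.lie) :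
    IsArchSmooth (H := u21Group) (cmArchSection L ι H T hT) (iterLieDeriv (cmArchSection L ι H T hT) w fun x => Φ x j) := by
  obtain ⟨hW, -, -, hH⟩ := CotangentForms.mem_holCotForms_iff.1 hΦ
  exact isArchSmooth_iterLieDeriv_apply_of_weight_isHolGerm (cmArchSection L ι H T hT) hW hH j w

/-- **L2B-i = F0P2a-p01's `sig_L2Bi`, TOKEN FOR TOKEN**: for every CM frame, every holomorphic cotangent form `Φ` and every coordinate `j`,
`x ↦ Φ x j` is `IsArchSmooth` for `U(2,1)` along `cmArchSection`. [cite: Borel1997, §5.14] [cite: BorelJacquet1979, §1.1 and §4.1] -/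
theorem sig_L2Bi_holds :
    ∀ (L : Type) [Field L] [NumberField L] [IsCMField L] (ι : L →+* ℂ) (H : Matrix (Fin 3) (Fin 3) L) (T : GL (Fin 3) ℂ)
      (hT : (T : Matrix (Fin 3) (Fin 3) ℂ)ᴴ * H.map ι * (T : Matrix (Fin 3) (Fin 3) ℂ) = Literature.Geometry.ComplexHyperbolic.BallModel.J),
      ∀ Φ ∈ CotangentForms.holCotForms (↥(maximalRealSubfield L)) L (IsCMField.complexConj L) 3 H (cmArchSection L ι H T hT)
        (cmCompactFactor L ι H T hT),
      ∀ j : Fin 2, IsArchSmooth (H := BallForms.u21Group) (cmArchSection L ι H T hT) (fun x => Φ x j) :=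
  fun L _ _ _ ι H T hT _ hΦ j => isArchSmooth_apply_of_mem_holCotForms_cm L ι H T hT hΦ j

end CM

end Summit.HodgeConjecture.HodgeConjecture.Cruxes.H413.F0P2aL2bHolArchSmooth

end
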